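import Literature.NumberTheory.EllipticCurves.CastellaGrossiSkinner2025.TwoVariablePAdicLFunctionII
import Literature.NumberTheory.EllipticCurves.YanZhu2026.GreenbergMainTheorems
import HarnessLib

/-!
# The two "CM newform of a Hecke character" predicates of the tree agree (proofs only)

A theorems-only reconciliation file (no definition, no named fact; D-0026; 0 debt) for row R1 of
the cross-ladder literature-typing layer (`pub/bsd-littype/OPEN-QUESTIONS-02.md` R1, seats 02/04,
2026-08-27): two predicates spelling "`θ` is the theta series (CM newform) of the Hecke character
`ψ`" landed on the same day in parallel seats —

* `Literature.NumberTheory.EllipticCurves.ModularForms.IsCMNewformOf ψ M k g` (Castella–Grossi–Skinner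
  2025 Thm. 2.4.1 typing, `CastellaGrossiSkinner2025/TwoVariablePAdicLFunctionII.lean`): newform on
  `Γ₁(M)` whose Hecke polynomial at every `ℓ ∤ M` is `∏_{w ∣ ℓ}(X^{f_w} − ψ(ϖ_w))`
  (`inducedFrobPolynomial`) AND, at such `ℓ`, `ℓ` unramified in `K` and `ψ` unramified above `ℓ` —
  VERBATIM the conclusion of the tree's named fact `Ribet1977_cmNewform_of_heckeCharacter`;
* `Literature.NumberTheory.EllipticCurves.IsCMNewformOf ψ θ` (Yan–Zhu 2026 Thm. 3.9 typing,
  `YanZhu2026/GreenbergMainTheorems.lean` §B; the predicate of the value frames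
  `IsGreenbergLFunctionAnyRoot₂` / `IsGreenbergLFunction₂`): the same newform + Hecke-polynomial
  clause WITHOUT the two unramifiedness conjuncts.

Hence the first implies the second (`ModularForms.IsCMNewformOf.isCMNewformOf`, by dropping
conjuncts), and Ribet's existence fact — already repackaged for the first predicate as
`ModularForms.exists_isCMNewformOf` — yields existence for the second
(`exists_isCMNewformOf_of_ribet`), which its home file records as "existence is Ribet's fact, not
used". The converse needs the level to see the ramification (not attempted; not needed by any
consumer). Source of both predicates: K. Ribet, *Galois representations attached to eigenforms
with Nebentypus*, LNM 601 (1977), §3 Thm. (3.4), Cor. (3.5) (Hecke–Shimura CM forms).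

References: [Ribet1977Nebentypus] §3; [CastellaGrossiSkinner2025] Thm. 2.4.1 (θ_{ψ_b});
[YanZhu2024MainConjNonCM] Thm. 3.9 (θ_{ξ_b}); tree `CMNewformOfHeckeCharacter.lean`.
-/

noncomputable section

open scoped ModularForm

open CongruenceSubgroup NumberField Literature.NumberTheory.GaloisRepresentations

namespace Literature.NumberTheory.EllipticCurves

variable {K : Type} [Field K] [NumberField K]

/-- **The Castella–Grossi–Skinner-side predicate implies the Yan–Zhu-side one**: a CM newform of
`ψ` in the sense of `ModularForms.IsCMNewformOf ψ M k g` (Ribet's conclusion verbatim) is one in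
the sense of `IsCMNewformOf ψ g` (newform + induced Hecke polynomials off the level).
[cite: Ribet1977Nebentypus, §3, Thm. (3.4), Cor. (3.5)] -/
theorem ModularForms.IsCMNewformOf.isCMNewformOf {ψ : HeckeCharacter K} {M : ℕ} [NeZero M]
    {k : ℕ} {g : CuspForm (Gamma1 M) (k : ℤ)} (h : ModularForms.IsCMNewformOf ψ M k g) :
    _root_.Literature.NumberTheory.EllipticCurves.IsCMNewformOf ψ g :=
  ⟨h.1, fun v hv ↦ (h.2 v hv).2.2⟩

/-- **Existence of the CM newform in the Yan–Zhu-side predicate, granted the Hecke–Shimura–Ribet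
fact**: every Hecke character of an imaginary quadratic field of infinity type `(k−1, 0)` or
`(0, k−1)`, `k ≥ 2`, has a `θ` with `IsCMNewformOf ψ θ` at some level (the home file of the
predicate: "existence is Ribet's fact, not used"). [cite: Ribet1977Nebentypus, §3, Thm. (3.4), Cor. (3.5) and Remark (3.5) (LNM 601, pp. 34–35)]
[cite: YanZhu2024MainConjNonCM, Thm. 3.9 (θ_{ξ_b}, arXiv:2412.20078v4 TeX l.845)] -/
theorem exists_isCMNewformOf_of_ribet (h : ModularForms.Ribet1977_cmNewform_of_heckeCharacter)
    (hK : Module.finrank ℚ K = 2) (hKr : ¬ IsTotallyReal K) {k : ℕ} (hk : 2 ≤ k)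
    {ψ : HeckeCharacter K}
    (hψ : ψ.HasInfinityType (fun _ => (k : ℤ) - 1) (fun _ => 0) ∨
      ψ.HasInfinityType (fun _ => 0) (fun _ => (k : ℤ) - 1)) :
    ∃ (M : ℕ) (_ : NeZero M) (θ : CuspForm (Gamma1 M) (k : ℤ)),
      _root_.Literature.NumberTheory.EllipticCurves.IsCMNewformOf ψ θ := by
  obtain ⟨M, hM, g, hg⟩ := ModularForms.exists_isCMNewformOf h hK hKr hk hψ
  exact ⟨M, hM, g, ModularForms.IsCMNewformOf.isCMNewformOf hg⟩

/-- The two predicates have the same newform clause and the same Hecke-polynomial clause: at a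
prime `ℓ ∤ M` both give `heckePolynomial = inducedFrobPolynomial` (so consumers of either can
quote the other's unfolding lemma). [cite: Ribet1977Nebentypus, §3, Thm. (3.4), Cor. (3.5)] -/
theorem ModularForms.IsCMNewformOf.heckePolynomial_eq_of_yanZhu {ψ : HeckeCharacter K} {M : ℕ}
    [NeZero M] {k : ℕ} {g : CuspForm (Gamma1 M) (k : ℤ)} (h : ModularForms.IsCMNewformOf ψ M k g)
    (v : IsDedekindDomain.HeightOneSpectrum (𝓞 ℚ))
    (hv : ¬ ((Rat.HeightOneSpectrum.primesEquiv v : Nat.Primes) : ℕ) ∣ M) :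
    (ModularForms.heckePolynomial g (Rat.HeightOneSpectrum.primesEquiv v : Nat.Primes)).map
        (algebraMap (ModularForms.coeffCharField g) ℂ) =
      inducedFrobPolynomial v (fun w => Polynomial.X - Polynomial.C (ψ.valueAtUniformizer w)) :=
  (ModularForms.IsCMNewformOf.isCMNewformOf h).heckePolynomial_eq v hv

end Literature.NumberTheory.EllipticCurves

end
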